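import Summits.Parity.GeneralizedHardyLittlewood.Theorems.PrimeLevelFamEdgeMomentsBeyondDiagonalDiagDecorOrderOneOneSplit
import Summits.Parity.GeneralizedHardyLittlewood.Theorems.PrimeLevelFamEdgeMomentsBeyondDiagonalDiagDecorOrderOneOneHecke
import Summits.Parity.GeneralizedHardyLittlewood.Theorems.PrimeLevelFamEdgeMomentsBeyondDiagonalDiagDecorOrderTargetNormalize
import Summits.Parity.GeneralizedHardyLittlewood.Theorems.PrimeLevelFamEdgeMomentsBeyondDiagonalDiagKernelFormProfile
import HarnessLib

/-!
# Route `PrimeLevelFamEdge`, crux K_A `MomentsBeyondDiagonal` (stmt-Parity-20007), line «petersson_layers» v4, stub `stub_diag`: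
# **THE ORDER-`(1,1)` TARGET (rung `N = 1` of `stub_diag`) FROM ONE REMAINDER ESTIMATE**

Census R3(ii): assembly of the g10 block calculus. The order-`(1,1)` target of
`…DiagOrderSelberg.subDiag_of_selbergOrderAsymptotics` (`i = j = 1`) follows, with the explicit functional
`τ₁₁(Δ′,P) = Δ′²·K₀(Δ′,P)/(2(π²/6)²)`, `K₀ = (π²/6)²(Φ₃(1/Δ′,P)/24 − Ψ₁(1/Δ′,P)/4)` (`…DecorOrderOneOnePoly`), from the single
remaining estimate

  (R)  `∃ E₀₀ E₀₁ E₁₀ E₁₁ μ₂, ∀ P admissible, ∀ Δ′ ∈ (1,Δ], ∃ C q₀, ∀ q ≥ q₀: |Sel_rem(q)| ≤ C/log q̂`,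

where `Sel_rem` is the remainder form of `…DecorOrderOneOneSplit` at `M = q̂^{Δ′}`, `Q = q̂` with the Bose coefficients
`c_ab(y) = ∫_{u₁>0}(log u₁)^a∫_{u₂>y/u₁}B(log u₂)^b` and the continued remainders `r_ab = c_ab − Π_ab(log(1/y))`
(`Π₀₀ = L/2 + E₀₀`, `Π₀₁ = −L²/8 + E₀₁`, `Π₁₀ = −L²/8 + E₁₀`, `Π₁₁ = L³/24 − 2μ₂L + E₁₁`; by
`…DiagBoseMixedStructure.bose_coeff_structure` + `…DecorBoseMuZero` the true constants make `|r_ab(y)| ≪ y(1+L)^{a+b+1}`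
on `y ≤ 1`, the input of `…DiagCornerBoseRem.abs_doubleSum_bose_rem_le`). Chain: `selbergOrderOneOne_hecke_eq` →
`selbergOrderOneOne_split` → `abs_selbergOrderOneOnePoly_sub_le` + (R) → `orderTarget_of_selbergAsymptotic`.

* `orderOneOne_target_of_remainder` — **(R) ⟹ the order-`(1,1)` target** (window `(1,Δ]`, any `Δ`).

Def-free; theorems only. Helper `--supports stmt-Parity-20007`; closes nothing (the remainder estimate (R) and all other
orders remain); K_A, K_B and the Parity summit are NOT proved; nothing about Landau–Siegel zeros.

## References
* E. Kowalski, P. Michel, J. VanderKam, J. reine angew. Math. 526 (2000), (23)–(28) pp. 13–15 and Prop. 5.1 p. 18.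
  [cite: KowalskiMichelVanderKam2000, (23)–(28) — derivation (order-(1,1) piece of the diagonal main term, general Q)]
-/

noncomputable section

open scoped Real ArithmeticFunction.Moebius
open Finset ArithmeticFunction Polynomial MeasureTheory Set

namespace Summit.Parity.GeneralizedHardyLittlewood.Theorems.MomentsBeyondDiagonal.DiagKernel

open Literature.NumberTheory.LFunctions Literature.NumberTheory.LFunctions.KMV2000

/-- **THE ORDER-`(1,1)` TARGET FROM THE REMAINDER ESTIMATE (R)** (see the module docstring).
[cite: KowalskiMichelVanderKam2000, (23)–(28) and Prop. 5.1 — derivation] -/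
theorem orderOneOne_target_of_remainder {Δ : ℝ}
    (hR : ∃ E₀₀ E₀₁ E₁₀ E₁₁ μ₂ : ℝ, ∀ P : ℝ[X], KMV2000.Admissible P → ∀ Δ' : ℝ, 1 < Δ' → Δ' ≤ Δ →
      ∃ C : ℝ, ∃ q₀ : ℕ, ∀ (q : ℕ) [NeZero q], q₀ ≤ q →
        |∑ c ∈ Icc 1 ⌊qhat q ^ Δ'⌋₊, ∑ g ∈ Icc 1 (⌊qhat q ^ Δ'⌋₊ / c), (μ g : ℝ) * c *
          ∑ k₁ ∈ Icc 1 (⌊qhat q ^ Δ'⌋₊ / (c * g)), ∑ k₂ ∈ Icc 1 (⌊qhat q ^ Δ'⌋₊ / (c * g)),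
            ((μ (c * g * k₁) : ℝ) * ((psi (c * g * k₁))⁻¹ *
                P.eval (Real.log (qhat q ^ Δ' / ((c * g * k₁ : ℕ) : ℝ)) / Real.log (qhat q ^ Δ')))) /
                ((c * g * k₁ : ℕ) : ℝ) *
              (((μ (c * g * k₂) : ℝ) * ((psi (c * g * k₂))⁻¹ *
                P.eval (Real.log (qhat q ^ Δ' / ((c * g * k₂ : ℕ) : ℝ)) / Real.log (qhat q ^ Δ')))) /
                ((c * g * k₂ : ℕ) : ℝ)) *
              ((k₁.divisors.card : ℝ) * (k₂.divisors.card : ℝ) *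
                (((2 * (Real.log (qhat q) - Real.log g) - Real.log k₁ - Real.log k₂) ^ 2 / 4 -
                    ((∑ p ∈ k₁.primeFactors, Real.log p ^ 2) + ∑ p ∈ k₂.primeFactors, Real.log p ^ 2) / 4) *
                  ((∫ u₁ in Ioi (0 : ℝ), ∫ u₂ in Ioi ((((g * g * (k₁ * k₂) : ℕ) : ℝ) / qhat q ^ 2) / u₁),
                      Real.exp (-(u₁ + u₂)) / (1 - Real.exp (-(u₁ + u₂))) ^ 2) -
                    (Real.log (qhat q ^ 2 / ((g * g * (k₁ * k₂) : ℕ) : ℝ)) / 2 + E₀₀)) +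
                (2 * (Real.log (qhat q) - Real.log g) - Real.log k₁ - Real.log k₂) / 2 *
                  (((∫ u₁ in Ioi (0 : ℝ), ∫ u₂ in Ioi ((((g * g * (k₁ * k₂) : ℕ) : ℝ) / qhat q ^ 2) / u₁),
                        Real.exp (-(u₁ + u₂)) / (1 - Real.exp (-(u₁ + u₂))) ^ 2 * Real.log u₂) -
                      (-(Real.log (qhat q ^ 2 / ((g * g * (k₁ * k₂) : ℕ) : ℝ)) ^ 2) / 8 + E₀₁)) +
                    ((∫ u₁ in Ioi (0 : ℝ), Real.log u₁ *
                        ∫ u₂ in Ioi ((((g * g * (k₁ * k₂) : ℕ) : ℝ) / qhat q ^ 2) / u₁),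
                          Real.exp (-(u₁ + u₂)) / (1 - Real.exp (-(u₁ + u₂))) ^ 2) -
                      (-(Real.log (qhat q ^ 2 / ((g * g * (k₁ * k₂) : ℕ) : ℝ)) ^ 2) / 8 + E₁₀))) +
                ((∫ u₁ in Ioi (0 : ℝ), Real.log u₁ *
                    ∫ u₂ in Ioi ((((g * g * (k₁ * k₂) : ℕ) : ℝ) / qhat q ^ 2) / u₁),
                      Real.exp (-(u₁ + u₂)) / (1 - Real.exp (-(u₁ + u₂))) ^ 2 * Real.log u₂) -
                  (Real.log (qhat q ^ 2 / ((g * g * (k₁ * k₂) : ℕ) : ℝ)) ^ 3 / 24 -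
                    2 * μ₂ * Real.log (qhat q ^ 2 / ((g * g * (k₁ * k₂) : ℕ) : ℝ)) + E₁₁))))| ≤
          C / Real.log (qhat q)) :
    ∀ P : ℝ[X], KMV2000.Admissible P → ∀ Δ' : ℝ, 1 < Δ' → Δ' ≤ Δ →
      ∃ C : ℝ, ∃ q₀ : ℕ, ∀ (q : ℕ) [NeZero q], q₀ ≤ q →
        |(Real.log (qhat q))⁻¹ ^ (1 + 1) * qhat q *
          (∑ c ∈ Icc 1 ⌊qhat q ^ Δ'⌋₊, ∑ g ∈ Icc 1 (⌊qhat q ^ Δ'⌋₊ / c), (μ g : ℝ) * c *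
            ∑ k₁ ∈ Icc 1 (⌊qhat q ^ Δ'⌋₊ / (c * g)), ∑ k₂ ∈ Icc 1 (⌊qhat q ^ Δ'⌋₊ / (c * g)),
              ((μ (c * g * k₁) : ℝ) * ((psi (c * g * k₁))⁻¹ *
                  P.eval (Real.log (qhat q ^ Δ' / ((c * g * k₁ : ℕ) : ℝ)) / Real.log (qhat q ^ Δ'))) /
                  ((c * g * k₁ : ℕ) : ℝ)) *
              ((μ (c * g * k₂) : ℝ) * ((psi (c * g * k₂))⁻¹ *
                  P.eval (Real.log (qhat q ^ Δ' / ((c * g * k₂ : ℕ) : ℝ)) / Real.log (qhat q ^ Δ'))) /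
                  ((c * g * k₂ : ℕ) : ℝ)) *
              ∑ d ∈ k₁.divisors, ∑ e ∈ k₂.divisors,
                ∫ u₁ in Ioi (0 : ℝ),
                  (Real.log (qhat q / ((k₁ / d * (g * e) : ℕ) : ℝ)) + Real.log u₁) ^ 1 *
                  ∫ u₂ in Ioi ((((k₁ / d * (g * e) * (g * d * (k₂ / e)) : ℕ) : ℝ) / qhat q ^ 2) / u₁),
                    Real.exp (-(u₁ + u₂)) / (1 - Real.exp (-(u₁ + u₂))) ^ 2 *
                    (Real.log (qhat q / ((g * d * (k₂ / e) : ℕ) : ℝ)) + Real.log u₂) ^ 1) -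
          2 * (π ^ 2 / 6) ^ 2 * (qhat q / (Δ' ^ 2 * Real.log (qhat q) ^ 2)) *
            (Δ' ^ 2 * ((π ^ 2 / 6) ^ 2 *
              ((∑ j ∈ Finset.range (3 + 1), ∑ i ∈ Finset.range (j + 1),
                  ((3 : ℕ).choose j : ℝ) * (j.choose i : ℝ) * 2 ^ (3 - j) *
                    ∫ u in (0 : ℝ)..1, (((Polynomial.C (1 / Δ') - X) ^ (3 - j) *
                      derivative (derivative (X ^ i * P))) * derivative (derivative (X ^ (j - i) * P))).eval u) / 24 -
                (∑ j ∈ Finset.range (1 + 1), ∑ i ∈ Finset.range (j + 1),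
                  ((1 : ℕ).choose j : ℝ) * (j.choose i : ℝ) * 2 ^ (1 - j) *
                    ∫ u in (0 : ℝ)..1, (((Polynomial.C (1 / Δ') - X) ^ (1 - j) * (-(2 : ℝ) • (X ^ i * P))) *
                      derivative (derivative (X ^ (j - i) * P))).eval u) / 4)) / (2 * (π ^ 2 / 6) ^ 2))| ≤
          C * qhat q * (Real.log (qhat q))⁻¹ ^ 3 := by
  obtain ⟨E₀₀, E₀₁, E₁₀, E₁₁, μ₂, hR⟩ := hR
  intro P hP Δ' h1 h2
  obtain ⟨hP0, hP1⟩ := coeff_zero_one_of_admissible hP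
  have hΔ0 : 0 < Δ' := by linarith
  have hlam0 : (0 : ℝ) ≤ 1 / Δ' := by positivity
  have hlam1 : 1 / Δ' ≤ 1 := (div_le_one hΔ0).2 h1.le
  obtain ⟨C_R, q_R, hRq⟩ := hR P hP Δ' h1 h2
  obtain ⟨C_P, hC_P, hpoly⟩ := abs_selbergOrderOneOnePoly_sub_le P hP0 hP1 hlam0 hlam1 E₀₀ ((E₀₁ + E₁₀) / 2 - 2 * μ₂) E₁₁
  obtain ⟨q₃, hq₃⟩ := exists_log_qhat_ge (2 : ℝ)
  refine orderTarget_of_selbergAsymptotic 1 1 _ _ hΔ0.ne' ⟨C_P / Δ' + C_R, max q_R q₃, fun q _ hq ↦ ?_⟩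
  have hqR : q_R ≤ q := le_trans (le_max_left _ _) hq
  have hl2 : (2 : ℝ) ≤ Real.log (qhat q) := hq₃ q (le_trans (le_max_right _ _) hq)
  have hQ0 : 0 ≤ qhat q := by unfold qhat; positivity
  have hQ : 0 < qhat q := lt_of_le_of_ne hQ0 fun h0 ↦ by
    rw [← h0, Real.log_zero] at hl2; linarith
  have hq3 : (3 : ℝ) ≤ qhat q := by
    have := Real.add_one_le_exp (Real.log (qhat q))
    rw [Real.exp_log hQ] at this
    linarith
  have hQ1 : 1 ≤ qhat q := by linarith
  have hM3 : 3 ≤ qhat q ^ Δ' := hq3.trans (Real.self_le_rpow_of_one_le hQ1 h1.le)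
  have hlogM : Real.log (qhat q ^ Δ') = Δ' * Real.log (qhat q) := Real.log_rpow hQ Δ'
  have hℓpos : 0 < Real.log (qhat q) := Real.log_pos (by linarith)
  have hlam : Real.log (qhat q) = 1 / Δ' * Real.log (qhat q ^ Δ') := by rw [hlogM]; field_simp
  -- exact Hecke form and split
  rw [selbergOrderOneOne_hecke_eq P (qhat q ^ Δ') ⌊qhat q ^ Δ'⌋₊ hQ]
  have hsplit := selbergOrderOneOne_split P (qhat q ^ Δ') hQ hlam
    (fun y ↦ ∫ u₁ in Ioi (0 : ℝ), ∫ u₂ in Ioi (y / u₁), Real.exp (-(u₁ + u₂)) / (1 - Real.exp (-(u₁ + u₂))) ^ 2)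
    (fun y ↦ ∫ u₁ in Ioi (0 : ℝ), ∫ u₂ in Ioi (y / u₁),
      Real.exp (-(u₁ + u₂)) / (1 - Real.exp (-(u₁ + u₂))) ^ 2 * Real.log u₂)
    (fun y ↦ ∫ u₁ in Ioi (0 : ℝ), Real.log u₁ * ∫ u₂ in Ioi (y / u₁),
      Real.exp (-(u₁ + u₂)) / (1 - Real.exp (-(u₁ + u₂))) ^ 2)
    (fun y ↦ ∫ u₁ in Ioi (0 : ℝ), Real.log u₁ * ∫ u₂ in Ioi (y / u₁),
      Real.exp (-(u₁ + u₂)) / (1 - Real.exp (-(u₁ + u₂))) ^ 2 * Real.log u₂) E₀₀ E₀₁ E₁₀ E₁₁ μ₂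
  beta_reduce at hsplit
  rw [hsplit]
  have hp := hpoly (qhat q ^ Δ') hM3
  have hr := hRq q hqR
  have key : ∀ {A B K c₁ c₂ : ℝ}, |A - K| ≤ c₁ → |B| ≤ c₂ → |A + B - K| ≤ c₁ + c₂ := by
    intro A B K c₁ c₂ hA hB
    calc |A + B - K| = |(A - K) + B| := by ring_nf
      _ ≤ |A - K| + |B| := abs_add_le _ _
      _ ≤ c₁ + c₂ := add_le_add hA hB
  convert key hp hr using 3
  · field_simp
  · rw [hlogM]
    field_simp

end Summit.Parity.GeneralizedHardyLittlewood.Theorems.MomentsBeyondDiagonal.DiagKernel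

end
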